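import Summits.QuantumFields.YangMills.Theorems.BalabanLadderNTMirrorHankelMirrorForm
import Summits.QuantumFields.YangMills.Theorems.BalabanLadderNTCumulantPolarisation
import HarnessLib

/-!
# Crux `NT` (stmt-QuantumFields-19353): the THREE-point floor in mirror shape also caps the lattice mass

Helper file (`--supports stmt-QuantumFields-19353`) of the fleet lead prover of crux `NT` (unit `ym-spine-19353-p1`,
g10), hypothesis-free; companion of `…MirrorHankelQ2Floor`.  The tree's cumulant polarisation
(`CumulantPolarisation.bareFloor_of_Q3_floor`, p547680) turns the clause-(ii) floor IN MIRROR SHAPE,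
`ε₃ ≤ |Q3 G r β L s v (θg) (θh)|`, together with a size-only four-point ceiling `B(P, P) ≤ M` (`P` the centred product of
the two reflected-species smearings), into the mirror floor `ε₃²/M ≤ mirrorForm G r β L Ṽ_v Ṽ_v` — EXACTLY.  Feeding this
into the cap of `…MirrorHankelMirrorForm`:

* **`q3MirrorFloor_caps_gap`** — at one coupling `β ≥ 0` and spacing `s`: the lattice supports of `v(s·)`, `g(s·)`, `h(s·)` in
  a cube `(c, b)` (the latter two at depth `≥ 2`), `1 ≤ c 0`; the cube in the box and `c 0 + b + 1 ≤ L` for `L ≥ L₀`; if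
  `ε₃ ≤ |Q3 G r β L s v (θg) (θh)|` and `B(P,P) ≤ M` on every torus `L ≥ L₀`, and the smearing `Ṽ₀` (the cube moved to the
  mirror, bounded by `K₀ > 0`) clusters in the shape of `GapInUnits` at lattice rate `μ`, then
  **`μ · 2(c 0) ≤ log (K₀² M / ε₃²)`**.

Reading (nothing registered): the Q3M floor of the seam's conjunct-3 discharge path (`UVSeamRec…OfQ3MirrorFloor`, p548128) pins
the lattice correlation length exactly like the two-point floor does: `ξ_lat(β) ≥ 2δ/(a(β)·log(K₀²M/ε₃²))`, `K₀²M ≍ a(β)^{−24}`-ish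
(three sup-norms of smearings), i.e. `ξ_lat ≳ δ/(12 a log(1/a))`.

Refs: J. Glimm, A. Jaffe, *Quantum Physics* (1987) §6.1; tree `CumulantPolarisation` (κ₃ as a mirror form).
-/

set_option autoImplicit false

noncomputable section

open scoped SchwartzMap
open MeasureTheory Finset
open Literature.MathematicalPhysics.QuantumFieldTheory Literature.MathematicalPhysics.QuantumLattice
open Literature.Probability.LatticeModels
open Summit.QuantumFields.YangMills.Cruxes.OSLegsFromFemtoAndGap.DlrCollarTransfer
open Summit.QuantumFields.YangMills.Cruxes.NT.CumulantPolarisation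
open Summit.QuantumFields.YangMills.Cruxes.NT.MarkovMirror (exists_isCylinder_cubeSmear)

namespace Summit.QuantumFields.YangMills.Cruxes.NT.MirrorHankel

variable {G : Type} [Group G] [TopologicalSpace G] [IsTopologicalGroup G] [CompactSpace G]
  [MeasurableSpace G] [BorelSpace G] {r : LatticeRep G}

/-- **Q3 floor in mirror shape on all large tori × clustering of the base smearing ⇒ `μ · 2(c 0) ≤ log(K₀² M/ε₃²)`.**
[cite: GlimmJaffe1987, §6.1] -/
theorem q3MirrorFloor_caps_gap {β : ℝ} (hβ : 0 ≤ β) (s : ℝ) (v g h : 𝓢(EuclideanSpace ℝ (Fin 4), ℝ))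
    (c : Fin 4 → ℤ) (b : ℕ) (hc1 : 1 ≤ c 0)
    (hv : ∀ x : Fin 4 → ℤ, v (s • siteToE x) ≠ 0 → x ∈ cubeSites c b)
    (hg : ∀ y : Fin 4 → ℤ, g (s • siteToE y) ≠ 0 → y ∈ cubeSites c b ∧ 2 ≤ depth c b y)
    (hh : ∀ z : Fin 4 → ℤ, h (s • siteToE z) ≠ 0 → z ∈ cubeSites c b ∧ 2 ≤ depth c b z)
    {K₀ : ℝ} (hK₀pos : 0 < K₀)
    (hK₀ : ∀ V, |cubeSmear G r (c - Pi.single 0 (c 0)) b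
      (fun x => v (s • siteToE (x + Pi.single 0 (c 0)))) V| ≤ K₀)
    {L₀ : ℕ} (hL₀ : c 0 + b + 1 ≤ (L₀ : ℤ)) (hsub : ∀ L : ℕ, L₀ ≤ L → cubeSites c b ⊆ box 4 L)
    {ε₃ M : ℝ} (hε₃ : 0 < ε₃)
    (hfloor : ∀ L : ℕ, L₀ ≤ L → ε₃ ≤ |Q3 G r β L s v (thetaTest 4 g) (thetaTest 4 h)|)
    (hceil : ∀ L : ℕ, L₀ ≤ L → mirrorForm G r β L
        (cprod G r β L (reflSmear G r c b fun y => g (s • siteToE y)) (reflSmear G r c b fun z => h (s • siteToE z)))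
        (cprod G r β L (reflSmear G r c b fun y => g (s • siteToE y)) (reflSmear G r c b fun z => h (s • siteToE z)))
        ≤ M)
    {C μ : ℝ} (hC : 0 < C)
    (hgap : ∀ L : ℕ, L₀ ≤ L → ∀ n : ℕ, n ≤ L →
      latticeConnectedCorr r.ρ β (2 * L + 1)
          (fun V => cubeSmear G r (c - Pi.single 0 (c 0)) b (fun x => v (s • siteToE (x + Pi.single 0 (c 0))))
            (cfgReflect V))
          (cubeSmear G r (c - Pi.single 0 (c 0)) b (fun x => v (s • siteToE (x + Pi.single 0 (c 0))))) n ≤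
        C * Real.exp (-(μ * n))) :
    μ * (2 * (c 0).toNat : ℕ) ≤ Real.log (K₀ ^ 2 / (ε₃ ^ 2 / M)) := by
  haveI := r.secondCountableTopology
  have hc0 : 0 ≤ c 0 := by linarith
  set c₀ : Fin 4 → ℤ := c - Pi.single 0 (c 0) with hc₀
  set w₀ : (Fin 4 → ℤ) → ℝ := fun x => v (s • siteToE (x + Pi.single 0 (c 0))) with hw₀
  have hc₀0 : 0 ≤ c₀ 0 := by simp [hc₀]
  have hcast : ((c 0).toNat : ℤ) = c 0 := Int.toNat_of_nonneg hc0
  have hcube : c₀ + Pi.single 0 (((c 0).toNat : ℕ) : ℤ) = c := by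
    rw [hcast, hc₀, sub_add_cancel]
  have hweights : (fun x => w₀ (x - Pi.single 0 (((c 0).toNat : ℕ) : ℤ))) = fun x => v (s • siteToE x) := by
    funext x; rw [hcast, hw₀]; simp only [sub_add_cancel]
  have hWm : Measurable (cubeSmear G r c₀ b w₀) := (continuous_cubeSmear' G r c₀ b w₀).measurable
  obtain ⟨SW, hWS, hSW⟩ := exists_isCylinder_cubeSmear G r c₀ b w₀
  -- the four-point ceiling is positive (from the floor on the first admissible torus)
  have hM : 0 < M := by
    exact (bareFloor_of_Q3_floor G r hβ c b L₀ hc1 (by exact_mod_cast hL₀) (hsub L₀ le_rfl) s v g h hv hg hh hε₃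
      (hfloor L₀ le_rfl) (hceil L₀ le_rfl)).1
  have hX : 0 < ε₃ ^ 2 / M := div_pos (pow_pos hε₃ 2) hM
  refine mirrorFloor_cubeSmear_caps_gap (r := r) hβ hc₀0 hWm hK₀pos hK₀ hWS hSW hX hC (fun L hL => ?_) hgap
  rw [hcube, hweights]
  have hcL : c 0 + (b : ℤ) + 1 ≤ L := by
    have : (L₀ : ℤ) ≤ L := by exact_mod_cast hL
    linarith
  exact (bareFloor_of_Q3_floor G r hβ c b L hc1 hcL (hsub L hL) s v g h hv hg hh hε₃ (hfloor L hL) (hceil L hL)).2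

end Summit.QuantumFields.YangMills.Cruxes.NT.MirrorHankel

end
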